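import Mathlib
import Summits.Ventures.PercRepro2.UniversalDoubling

/-! # (UH*) for `X` in series with a theta-structured network — the structure and the pointwise certificate
(seat mine-b, cell pub-perc-repro2; MINE-B.md §22.8)

`universal_doubling` (UniversalDoubling.lean) treats `X ∧ B₂`.  The same relay certificate works for any labelled
poset `Y` with the **theta structure** `ThetaData`: labels in `{(0,0), (0,1), (1,0), (1,1), (2,0), (0,2)}`, a
single top `t` of label `(0,2)` (every other element has blue label `≤ 1`), three elements `y00 (2,0)`,
`yA ≠ yB (1,1)` below `t`, and an injective choice `τ` of a `(1,0)`-element below each `(0,1)`-element.  This is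
the structure of the configuration cube of two paths in parallel `P_j ∗ P_k` (the top = both paths blue; `y00` = both
red; `yA`, `yB` = one path blue and the other red; `τ` = turn the blue path red), so with the series closure of the
family it gives (UH*) on every series–parallel network of max flow ≤ 2 (the SP plumbing is not in this file).

Certificate (φ-formulation, `universal_of_phi`): `G_1` on the slice of `y00` at level 1 (the top's level-1 sources),
`V2_2` on `yB` at level 2 (the top's level-2 sources), the level-1 Harris weight on every `(1,1)`-fibre (its own
sources) and on every `τ`-image (the sources of the `(0,1)`-fibre above it), and containments: top → `y00` / `yA` /
`yB` as for `B₂`, and `(0,1)`-fibre → its `τ`-image for all its sources. -/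

namespace Summit.Ventures.PercRepro2.UHClosure

open Finset

variable {X : Type*} [Preorder X] [Fintype X] {Y : Type*} [Preorder Y] [Fintype Y] [DecidableEq Y]

/-- the theta structure on a labelled poset `Y` -/
structure ThetaData (ρ β : Y → ℕ) where
  /-- the top: the only element of blue label 2 -/
  t : Y
  ht : ρ t = 0 ∧ β t = 2
  hlab : ∀ y, (ρ y = 0 ∧ β y = 0) ∨ (ρ y = 0 ∧ β y = 1) ∨ (ρ y = 1 ∧ β y = 0) ∨ (ρ y = 1 ∧ β y = 1) ∨
    (ρ y = 2 ∧ β y = 0) ∨ y = t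
  /-- the bottom-type element -/
  y00 : Y
  h00 : ρ y00 = 2 ∧ β y00 = 0 ∧ y00 ≤ t
  /-- the two `(1,1)`-elements below the top -/
  yA : Y
  yB : Y
  hA : ρ yA = 1 ∧ β yA = 1 ∧ yA ≤ t
  hB : ρ yB = 1 ∧ β yB = 1 ∧ yB ≤ t
  hAB : yA ≠ yB
  /-- the relay of the `(0,1)`-elements to `(1,0)`-elements below them -/
  τ : Y → Y
  hτ : ∀ y, ρ y = 0 → β y = 1 → τ y ≤ y ∧ ρ (τ y) = 1 ∧ β (τ y) = 0
  hτinj : ∀ y y', ρ y = 0 → β y = 1 → ρ y' = 0 → β y' = 1 → τ y = τ y' → y = y'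

variable (r b : X → ℕ) (ρ β : Y → ℕ)

/-- the red label of the series product -/
abbrev tR : X × Y → ℕ := fun p => min (r p.1) (ρ p.2)
/-- the blue label of the series product -/
abbrev tB : X × Y → ℕ := fun p => min (b p.1) (β p.2)

section cert

variable (D : ThetaData ρ β)

/-- `y` is a `(0,1)`-element -/
def is01 (y : Y) : Prop := ρ y = 0 ∧ β y = 1

/-- decidable -/
instance (y : Y) : Decidable (is01 ρ β y) := inferInstanceAs (Decidable (ρ y = 0 ∧ β y = 1))
/-- `y` is a `(1,1)`-element -/
def is11 (y : Y) : Prop := ρ y = 1 ∧ β y = 1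

/-- decidable -/
instance (y : Y) : Decidable (is11 ρ β y) := inferInstanceAs (Decidable (ρ y = 1 ∧ β y = 1))
/-- `y` is the `τ`-image of a `(0,1)`-element -/
def isImg (y : Y) : Prop := ∃ y', is01 ρ β y' ∧ D.τ y' = y

/-- decidable by finiteness -/
instance (y : Y) : Decidable (isImg ρ β D y) := by unfold isImg; infer_instance

/-- the statement part of the certificate -/
noncomputable def tcertS (a c : ℕ) (y : Y) (m : ℕ∞) : ℤ :=
  (if y = D.y00 ∧ m ≤ 1 then gw 1 a c else 0) + (if y = D.yB ∧ m ≤ 2 then vw 2 a c else 0)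
    + (if is11 ρ β y ∧ m ≤ 1 then hwOne a c else 0) + (if isImg ρ β D y ∧ m ≤ 1 then hwOne a c else 0)

/-- the multiplier of the `(0,1)`-fibre containments: every source of such a fibre (`c ≥ 1`, any `a`) -/
def mu01 (c : ℕ) : ℤ := if 1 ≤ c then 1 else 0

/-- the containment part of the certificate -/
noncomputable def tcertC (a c : ℕ) (y : Y) (m : ℕ∞) : ℤ :=
  mu1 a c * (indL (y = D.y00 ∧ m ≤ 1) - indL (y = D.t ∧ m ≤ 1))
    + mu2 a c * (indL (y = D.yB ∧ m ≤ 2) - indL (y = D.t ∧ m ≤ 2))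
    + mu3 a c * (indL (y = D.yA ∧ m ≤ 1) - indL (y = D.t ∧ m ≤ 1))
    + mu4 a c * (indL (y = D.yA ∧ m ≤ 2) + indL (y = D.yB ∧ m ≤ 2) - 2 * indL (y = D.t ∧ m ≤ 2))
    + mu01 c * (indL (isImg ρ β D y ∧ m ≤ 1) - indL (is01 ρ β y ∧ m ≤ 1))

end cert

/-! ### the pointwise inequality, in terms of the role pattern of a fibre -/

/-- the φ-weight of the product at labels `(a,c)`, fibre labels `(ρy, βy)`, natural value `n` -/
def tw' (a c ρy βy n : ℕ) : ℤ :=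
  (if min a ρy = 1 ∧ n ≤ min c βy + 1 then 1 else 0)
    - (if min a ρy = 0 ∧ n ≤ min c βy then ((min c βy : ℕ) : ℤ) else 0)

/-- the certificate at natural values, by the role pattern of the fibre:
`bT` top, `b00` the bottom-type element, `bA`, `bB` the two special `(1,1)`-elements, `b11` any `(1,1)`-element,
`bI` a `τ`-image, `b01` a `(0,1)`-element -/
def tcert' (a c : ℕ) (bT b00 bA bB b11 bI b01 : Bool) (n : ℕ) : ℤ :=
  (if b00 ∧ n ≤ 1 then gw 1 a c else 0) + (if bB ∧ n ≤ 2 then vw 2 a c else 0)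
    + (if b11 ∧ n ≤ 1 then hwOne a c else 0) + (if bI ∧ n ≤ 1 then hwOne a c else 0)
    + (mu1 a c * (indL (b00 ∧ n ≤ 1) - indL (bT ∧ n ≤ 1))
    + mu2 a c * (indL (bB ∧ n ≤ 2) - indL (bT ∧ n ≤ 2))
    + mu3 a c * (indL (bA ∧ n ≤ 1) - indL (bT ∧ n ≤ 1))
    + mu4 a c * (indL (bA ∧ n ≤ 2) + indL (bB ∧ n ≤ 2) - 2 * indL (bT ∧ n ≤ 2))
    + mu01 c * (indL (bI ∧ n ≤ 1) - indL (b01 ∧ n ≤ 1)))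

/-- the pointwise certificate on a fibre of role `top` -/
lemma tcert_le_top (a c n : ℕ) : tcert' a c true false false false false false false n ≤ tw' a c 0 2 n := by
  unfold tcert' tw' gw vw hwOne indL mu1 mu2 mu3 mu4 mu01
  simp only [Bool.false_eq_true, true_and, false_and, if_false]
  split_ifs <;> omega

/-- the pointwise certificate on a fibre of role `y00` -/
lemma tcert_le_y00 (a c n : ℕ) : tcert' a c false true false false false false false n ≤ tw' a c 2 0 n := by
  unfold tcert' tw' gw vw hwOne indL mu1 mu2 mu3 mu4 mu01
  simp only [Bool.false_eq_true, true_and, false_and, if_false]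
  split_ifs <;> omega

/-- the pointwise certificate on a fibre of role `yA` -/
lemma tcert_le_yA (a c n : ℕ) : tcert' a c false false true false true false false n ≤ tw' a c 1 1 n := by
  unfold tcert' tw' gw vw hwOne indL mu1 mu2 mu3 mu4 mu01
  simp only [Bool.false_eq_true, true_and, false_and, if_false]
  split_ifs <;> omega

/-- the pointwise certificate on a fibre of role `yB` -/
lemma tcert_le_yB (a c n : ℕ) : tcert' a c false false false true true false false n ≤ tw' a c 1 1 n := by
  unfold tcert' tw' gw vw hwOne indL mu1 mu2 mu3 mu4 mu01
  simp only [Bool.false_eq_true, true_and, false_and, if_false]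
  split_ifs <;> omega

/-- the pointwise certificate on a fibre of role `o11` -/
lemma tcert_le_o11 (a c n : ℕ) : tcert' a c false false false false true false false n ≤ tw' a c 1 1 n := by
  unfold tcert' tw' gw vw hwOne indL mu1 mu2 mu3 mu4 mu01
  simp only [Bool.false_eq_true, true_and, false_and, if_false]
  split_ifs <;> omega

/-- the pointwise certificate on a fibre of role `img` -/
lemma tcert_le_img (a c n : ℕ) : tcert' a c false false false false false true false n ≤ tw' a c 1 0 n := by
  unfold tcert' tw' gw vw hwOne indL mu1 mu2 mu3 mu4 mu01
  simp only [Bool.false_eq_true, true_and, false_and, if_false]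
  split_ifs <;> omega

/-- the pointwise certificate on a fibre of role `y01` -/
lemma tcert_le_y01 (a c n : ℕ) : tcert' a c false false false false false false true n ≤ tw' a c 0 1 n := by
  unfold tcert' tw' gw vw hwOne indL mu1 mu2 mu3 mu4 mu01
  simp only [Bool.false_eq_true, true_and, false_and, if_false]
  split_ifs <;> omega

/-- the pointwise certificate on a fibre with no role (labels `(0,0)`, `(1,0)`, `(2,0)`) -/
lemma tcert_le_none (a c ρy βy n : ℕ)
    (h : (ρy = 0 ∧ βy = 0) ∨ (ρy = 1 ∧ βy = 0) ∨ (ρy = 2 ∧ βy = 0)) :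
    tcert' a c false false false false false false false n ≤ tw' a c ρy βy n := by
  rcases h with ⟨hρ, hβ⟩ | ⟨hρ, hβ⟩ | ⟨hρ, hβ⟩ <;> subst hρ hβ <;>
    (unfold tcert' tw' gw vw hwOne indL mu1 mu2 mu3 mu4 mu01
     simp only [Bool.false_eq_true, false_and, if_false]
     split_ifs <;> omega)

/-! ### the pointwise certificate on the actual fibres -/

section pointwise

variable (D : ThetaData ρ β)

/-- the certificate at a natural value equals the pattern form -/
lemma tcert_coe_eq (a c : ℕ) (y : Y) (n : ℕ) (bT b00 bA bB b11 bI b01 : Bool)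
    (hT : (y = D.t) ↔ bT = true) (h00 : (y = D.y00) ↔ b00 = true) (hA : (y = D.yA) ↔ bA = true)
    (hB : (y = D.yB) ↔ bB = true) (h11 : is11 ρ β y ↔ b11 = true) (hI : isImg ρ β D y ↔ bI = true)
    (h01 : is01 ρ β y ↔ b01 = true) :
    tcertS ρ β D a c y (n : ℕ∞) + tcertC ρ β D a c y (n : ℕ∞) = tcert' a c bT b00 bA bB b11 bI b01 n := by
  have e1 : ((n : ℕ∞) ≤ 1) ↔ n ≤ 1 := by exact_mod_cast Iff.rfl
  have e2 : ((n : ℕ∞) ≤ 2) ↔ n ≤ 2 := by exact_mod_cast Iff.rfl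
  simp only [tcertS, tcertC, tcert', hT, h00, hA, hB, h11, hI, h01, e1, e2]

omit [Preorder X] [Fintype X] [Preorder Y] [Fintype Y] [DecidableEq Y] in
/-- the φ-weight of the product at a natural value -/
lemma tuw_coe (z : X × Y) (n : ℕ) : uw (tR r ρ) (tB b β) z (n : ℕ∞) = tw' (r z.1) (b z.1) (ρ z.2) (β z.2) n := by
  have h1 : ∀ k : ℕ, ((n : ℕ∞) ≤ (k : ℕ∞) + 1) ↔ n ≤ k + 1 := fun k => by exact_mod_cast Iff.rfl
  have h2 : ∀ k : ℕ, ((n : ℕ∞) ≤ (k : ℕ∞)) ↔ n ≤ k := fun k => by exact_mod_cast Iff.rfl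
  simp only [uw, tw', tR, tB, h1, h2]

omit [Preorder X] [Fintype X] [Preorder Y] [Fintype Y] [DecidableEq Y] in
/-- the φ-weight vanishes at `⊤` -/
lemma tuw_top (z : X × Y) : uw (tR r ρ) (tB b β) z ⊤ = 0 := by simp [uw]

/-- the certificate vanishes at `⊤` -/
lemma tcert_top (a c : ℕ) (y : Y) : tcertS ρ β D a c y ⊤ + tcertC ρ β D a c y ⊤ = 0 := by
  simp [tcertS, tcertC, indL]

omit [Preorder X] [Fintype X] in
/-- the pointwise certificate at natural values, for every fibre -/
lemma tcert_le_fibre (a c : ℕ) (y : Y) (n : ℕ) :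
    tcertS ρ β D a c y (n : ℕ∞) + tcertC ρ β D a c y (n : ℕ∞) ≤ tw' a c (ρ y) (β y) n := by
  have ht := D.ht; have h00 := D.h00; have hA := D.hA; have hB := D.hB
  by_cases hyT : y = D.t
  · subst hyT
    have n00 : ¬ (D.t = D.y00) := fun h => by rw [← h] at h00; omega
    have nA : ¬ (D.t = D.yA) := fun h => by rw [← h] at hA; omega
    have nB : ¬ (D.t = D.yB) := fun h => by rw [← h] at hB; omega
    have n11 : ¬ is11 ρ β D.t := fun h => by unfold is11 at h; omega
    have nI : ¬ isImg ρ β D D.t := fun ⟨y', hy', he⟩ => by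
      have := (D.hτ y' hy'.1 hy'.2).2.1; rw [he] at this; omega
    have n01 : ¬ is01 ρ β D.t := fun h => by unfold is01 at h; omega
    rw [tcert_coe_eq ρ β D a c D.t n true false false false false false false (iff_of_true rfl rfl)
      (iff_of_false n00 (by decide)) (iff_of_false nA (by decide)) (iff_of_false nB (by decide)) (iff_of_false n11 (by decide))
      (iff_of_false nI (by decide)) (iff_of_false n01 (by decide)), ht.1, ht.2]
    exact tcert_le_top a c n
  by_cases hy00 : y = D.y00
  · subst hy00
    have nA : ¬ (D.y00 = D.yA) := fun h => by rw [← h] at hA; omega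
    have nB : ¬ (D.y00 = D.yB) := fun h => by rw [← h] at hB; omega
    have n11 : ¬ is11 ρ β D.y00 := fun h => by unfold is11 at h; omega
    have nI : ¬ isImg ρ β D D.y00 := fun ⟨y', hy', he⟩ => by
      have := (D.hτ y' hy'.1 hy'.2).2.1; rw [he] at this; omega
    have n01 : ¬ is01 ρ β D.y00 := fun h => by unfold is01 at h; omega
    rw [tcert_coe_eq ρ β D a c D.y00 n false true false false false false false (iff_of_false hyT (by decide))
      (iff_of_true rfl rfl) (iff_of_false nA (by decide)) (iff_of_false nB (by decide)) (iff_of_false n11 (by decide))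
      (iff_of_false nI (by decide)) (iff_of_false n01 (by decide)), h00.1, h00.2.1]
    exact tcert_le_y00 a c n
  by_cases hyA : y = D.yA
  · subst hyA
    have nB : ¬ (D.yA = D.yB) := D.hAB
    have i11 : is11 ρ β D.yA := ⟨hA.1, hA.2.1⟩
    have nI : ¬ isImg ρ β D D.yA := fun ⟨y', hy', he⟩ => by
      have := (D.hτ y' hy'.1 hy'.2).2.2; rw [he] at this; omega
    have n01 : ¬ is01 ρ β D.yA := fun h => by unfold is01 at h; omega
    rw [tcert_coe_eq ρ β D a c D.yA n false false true false true false false (iff_of_false hyT (by decide))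
      (iff_of_false hy00 (by decide)) (iff_of_true rfl rfl) (iff_of_false nB (by decide)) (iff_of_true i11 rfl)
      (iff_of_false nI (by decide)) (iff_of_false n01 (by decide)), hA.1, hA.2.1]
    exact tcert_le_yA a c n
  by_cases hyB : y = D.yB
  · subst hyB
    have i11 : is11 ρ β D.yB := ⟨hB.1, hB.2.1⟩
    have nI : ¬ isImg ρ β D D.yB := fun ⟨y', hy', he⟩ => by
      have := (D.hτ y' hy'.1 hy'.2).2.2; rw [he] at this; omega
    have n01 : ¬ is01 ρ β D.yB := fun h => by unfold is01 at h; omega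
    rw [tcert_coe_eq ρ β D a c D.yB n false false false true true false false (iff_of_false hyT (by decide))
      (iff_of_false hy00 (by decide)) (iff_of_false hyA (by decide)) (iff_of_true rfl rfl) (iff_of_true i11 rfl)
      (iff_of_false nI (by decide)) (iff_of_false n01 (by decide)), hB.1, hB.2.1]
    exact tcert_le_yB a c n
  by_cases hy11 : is11 ρ β y
  · have nI : ¬ isImg ρ β D y := fun ⟨y', hy', he⟩ => by
      have := (D.hτ y' hy'.1 hy'.2).2.2; rw [he] at this; unfold is11 at hy11; omega
    have n01 : ¬ is01 ρ β y := fun h => by unfold is01 at h; unfold is11 at hy11; omega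
    rw [tcert_coe_eq ρ β D a c y n false false false false true false false (iff_of_false hyT (by decide))
      (iff_of_false hy00 (by decide)) (iff_of_false hyA (by decide)) (iff_of_false hyB (by decide)) (iff_of_true hy11 rfl)
      (iff_of_false nI (by decide)) (iff_of_false n01 (by decide)), hy11.1, hy11.2]
    exact tcert_le_o11 a c n
  by_cases hyI : isImg ρ β D y
  · obtain ⟨y', hy', he⟩ := hyI
    have hl := D.hτ y' hy'.1 hy'.2
    rw [he] at hl
    have n01 : ¬ is01 ρ β y := fun h => by unfold is01 at h; omega
    rw [tcert_coe_eq ρ β D a c y n false false false false false true false (iff_of_false hyT (by decide))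
      (iff_of_false hy00 (by decide)) (iff_of_false hyA (by decide)) (iff_of_false hyB (by decide)) (iff_of_false hy11 (by decide))
      (iff_of_true ⟨y', hy', he⟩ rfl) (iff_of_false n01 (by decide)), hl.2.1, hl.2.2]
    exact tcert_le_img a c n
  by_cases hy01 : is01 ρ β y
  · rw [tcert_coe_eq ρ β D a c y n false false false false false false true (iff_of_false hyT (by decide))
      (iff_of_false hy00 (by decide)) (iff_of_false hyA (by decide)) (iff_of_false hyB (by decide)) (iff_of_false hy11 (by decide))
      (iff_of_false hyI (by decide)) (iff_of_true hy01 rfl), hy01.1, hy01.2]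
    exact tcert_le_y01 a c n
  · rw [tcert_coe_eq ρ β D a c y n false false false false false false false (iff_of_false hyT (by decide))
      (iff_of_false hy00 (by decide)) (iff_of_false hyA (by decide)) (iff_of_false hyB (by decide)) (iff_of_false hy11 (by decide))
      (iff_of_false hyI (by decide)) (iff_of_false hy01 (by decide))]
    apply tcert_le_none
    rcases D.hlab y with h | h | h | h | h | h
    · exact Or.inl h
    · exact absurd h hy01
    · exact Or.inr (Or.inl h)
    · exact absurd h hy11
    · exact Or.inr (Or.inr h)
    · exact absurd h hyT

omit [Preorder X] [Fintype X] in
/-- **the pointwise certificate** -/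
lemma tcert_le (z : X × Y) (m : ℕ∞) :
    tcertS ρ β D (r z.1) (b z.1) z.2 m + tcertC ρ β D (r z.1) (b z.1) z.2 m ≤ uw (tR r ρ) (tB b β) z m := by
  induction m using ENat.recTopCoe with
  | top => rw [tcert_top, tuw_top]
  | coe n => rw [tuw_coe]; exact tcert_le_fibre ρ β D (r z.1) (b z.1) z.2 n

end pointwise

end Summit.Ventures.PercRepro2.UHClosure
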